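import Summits.BirchSwinnertonDyer.BirchSwinnertonDyer.Theorems.SignedLowerHalvesSmallImageLowerHalfBothSignsRttD2SeqJ3RSeqCofree
import Literature.NumberTheory.GaloisRepresentations.LocalDualityDescent
import Literature.NumberTheory.EllipticCurves.GreenbergSelmerCofreeReductionPkProofs
import HarnessLib

/-!
# Route `SignedLowerHalves`, crux L `SmallImageLowerHalfBothSigns` (stmt-BirchSwinnertonDyer-23599), line `rtt_w3` v21 → v22 — E2, row J3: THE PERFECTNESS
# HYPOTHESIS `hperf` OF J3 (`exists_junction_exact_cofree_lam_free`) REDUCED TO TWO FRAME-LEVEL FACTS — (i) `N_P` acts trivially on `𝒪 ⊗ μ_{p^m} ⊗ θ′`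
# (so `X_m = (𝒪 ⊗ μ_{p^m} ⊗ θ′)^{N_P}` is everything), (ii) `λ` is PERFECT mod `p^m` (`t ↦ λ(·t) : 𝒪/p^m ≅ Hom(𝒪, ℤ/p^m)`)

WIDTH seat `bsd-line-slh-p3-w3` g24 under LEAD `cruxlead-stmt-BirchSwinnertonDyer-23599` g12 (cell `bsd-ssimc`); helper `--supports stmt-BirchSwinnertonDyer-23599`.
THEOREMS ONLY (no definition, no named fact, no instance, no `sorry`). HONEST FRAMING: pure linear algebra of the level pairing `⟪b ⊗ ζ, t/p^m⟫ = λ(b t)·ζ`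
(`cofreeLamCoeffPairingK`, g23 p795664) on `X_m × M[p^m]`, `M = Cofree θ F`: with (i) every `b ⊗ ζ` is `N_P`-invariant, so injectivity of `a ↦ ⟪·, a⟫` is the
non-degeneracy of `λ mod p^m` and surjectivity is its perfectness (every additive `𝒪 → ℤ/p^m` is `λ(·t)`), the roots of unity being cyclic (`μ_{p^m}(K̄) ≃ ℤ/p^m`,
tree `muEquivZMod`). (i) holds when `θ′|_{N_P} = 1` (LEAD p792933) and `μ_{p^∞}` is unramified outside `P ∋ v ∣ p`; (ii) holds for `λ = Tr_{𝒪/ℤ_p}` when `𝒪/ℤ_p` is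
unramified, and for `λ = Tr(δ⁻¹·)` in general — the junction hand's choice of `lam`. E2, crux L, crux M, BSD remain OPEN and are proved for NO curve.

* `mem_invariants_muTwistO_of_forall` — (i) ⇒ `x ∈ X_m` for every `x : 𝒪 ⊗ μ_{p^m}`;
* `exists_generator_muCarrier` (`μ_{p^m} = ℤ·ζ₀`, order `p^m`), `exists_eq_tmul_of_generator` (`𝒪 ⊗ μ_{p^m} = {b ⊗ ζ₀}`), `cofreeLamCoeffPairingK_toLin_tmul_divPowTors` (the value `λ(bt)·ζ`);
* ★★★ `bijective_flip_cofreeLamCoeffPairingK` — `hperf` at level `m` from (i) + (ii) (`hlamInj`, `hlamSurj`).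
References: [Rubin2000] §4.2; [NeukirchSchmidtWingberg2008] (7.2.6), I §5 Prop. 1.5.3; [Kato2004Asterisque] §13.8, §17.13; [SerreLocalFields1979] III §3 (different / trace form).
-/

set_option autoImplicit false
set_option linter.dupNamespace false -- D-0017: single-problem summit, the namespace repeats the problem name by design
noncomputable section

open scoped Classical
open NumberField IsDedekindDomain Field Matrix CategoryTheory Function

namespace Summit.BirchSwinnertonDyer.BirchSwinnertonDyer.Theorems.SmallImageRttD2Seq

open Literature.NumberTheory.EllipticCurves Literature.NumberTheory.EllipticCurves.GreenbergSelmer Literature.NumberTheory.GaloisRepresentations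
  Literature.NumberTheory.GaloisRepresentations.DiscreteGaloisModule
  Literature.NumberTheory.ComplexMultiplication.EllipticUnits.JohnsonLeungKings2011
  Summit.BirchSwinnertonDyer.BirchSwinnertonDyer.Theorems.SmallImageRttD2J1

/-! ## §1. `X_m` is everything when `N_P` acts trivially -/

section Invariants

variable {K : Type} [Field K] [NumberField K] {p : ℕ} [Fact p.Prime] (S : Set (PadicAlgCl p))
  (θ' : absoluteGaloisGroup K →ₜ* (padicCoeffIntegers S)ˣ) (P : Set (HeightOneSpectrum (𝓞 K)))

omit [NumberField K] in
/-- **`(𝒪 ⊗ μ_{p^m} ⊗ θ′)^{N_P} = 𝒪 ⊗ μ_{p^m}`** when `θ′` is trivial on `N_P` and `N_P` fixes `μ_{p^m}(K̄)`: every element is invariant (pure tensors by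
`σ·(b ⊗ ζ) = θ′(σ)b ⊗ σζ`, then additivity). [cite: NeukirchSchmidtWingberg2008, (7.2.6)] [cite: Kato2004Asterisque, §17.13] -/
theorem mem_invariants_muTwistO_of_forall (m : ℕ) (hθN : ∀ g ∈ ramificationSubgroup K P, θ' g = 1)
    (hμN : ∀ g ∈ ramificationSubgroup K P, ∀ ζ : MuCarrier K (p ^ m), mu K (p ^ m) g ζ = ζ) (x : OMuCarrier K S (p ^ m)) :
    x ∈ Representation.invariants ((muTwistO S θ' m).toRepresentation.comp (ramificationSubgroup K P).subtype) := by
  rw [Representation.mem_invariants]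
  intro g
  simp only [MonoidHom.coe_comp, Subgroup.coe_subtype, Function.comp_apply, ContinuousRep.toRepresentation_apply]
  induction x using OMuCarrier.induction_on with
  | zero => exact map_zero _
  | tmul a v => rw [muTwistO_tmul_of_apply_eq_one S θ' m (hθN g g.2), hμN g g.2]
  | add y z hy hz => rw [map_add, hy, hz]

end Invariants

/-! ## §2. `μ_{p^m}(K̄)` is cyclic of order `p^m`; `𝒪 ⊗ μ_{p^m} = {b ⊗ ζ₀}` -/

section Mu

variable (K : Type) [Field K] [NumberField K] {p : ℕ} [Fact p.Prime] (S : Set (PadicAlgCl p))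

/-- **A generator `ζ₀` of `μ_{p^m}(K̄)` of exact order `p^m`**, together with the additive isomorphism `e : μ_{p^m}(K̄) ≃ ℤ/p^m` sending `ζ₀ ↦ 1` (tree `muEquivZMod`).
[cite: SerreLocalFields1979, IV §4 (roots of unity)] [folklore] -/
theorem exists_generator_muCarrier (m : ℕ) :
    ∃ (e : MuCarrier K (p ^ m) ≃+ ZMod (p ^ m)) (ζ₀ : MuCarrier K (p ^ m)), e ζ₀ = 1 ∧ (∀ ζ : MuCarrier K (p ^ m), ζ = ((e ζ).val : ℤ) • ζ₀) ∧
      ∀ k : ℤ, k • ζ₀ = 0 ↔ ((p ^ m : ℕ) : ℤ) ∣ k := by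
  haveI : NeZero (p ^ m) := ⟨pow_ne_zero _ (Fact.out : p.Prime).ne_zero⟩
  let e : MuCarrier K (p ^ m) ≃+ ZMod (p ^ m) := muEquivZMod K (p ^ m)
  refine ⟨e, e.symm 1, e.apply_symm_apply 1, fun ζ ↦ ?_, fun k ↦ ?_⟩
  · apply e.injective
    rw [map_zsmul, e.apply_symm_apply, zsmul_eq_mul, mul_one, Int.cast_natCast, ZMod.natCast_zmod_val]
  · rw [← e.map_eq_zero_iff, map_zsmul, e.apply_symm_apply, zsmul_eq_mul, mul_one, ZMod.intCast_zmod_eq_zero_iff_dvd]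

omit [NumberField K] in
/-- `b ⊗ (k·ζ) = (k·b) ⊗ ζ` in `𝒪 ⊗_ℤ μ`. [folklore] -/
theorem tmul_zsmul_eq {n : ℕ} (a : padicCoeffIntegers S) (k : ℤ) (v : MuCarrier K n) :
    OMuCarrier.tmul (K := K) a (k • v) = OMuCarrier.tmul (k • a) v := by
  change OMuCarrier.toTensor.symm (a ⊗ₜ[ℤ] (k • v)) = OMuCarrier.toTensor.symm ((k • a) ⊗ₜ[ℤ] v)
  rw [TensorProduct.smul_tmul]

omit [NumberField K] in
/-- `0 ⊗ ζ = 0`. [folklore] -/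
theorem zero_tmul_eq {n : ℕ} (v : MuCarrier K n) : OMuCarrier.tmul (K := K) (S := S) 0 v = 0 := by
  change OMuCarrier.toTensor.symm ((0 : padicCoeffIntegers S) ⊗ₜ[ℤ] v) = 0
  rw [TensorProduct.zero_tmul, map_zero]

omit [NumberField K] in
/-- **`𝒪 ⊗ μ_{p^m} = {b ⊗ ζ₀ : b ∈ 𝒪}`** for a generator `ζ₀` of the cyclic group `μ_{p^m}(K̄)`. [cite: NeukirchSchmidtWingberg2008, (7.2.6)] [folklore] -/
theorem exists_eq_tmul_of_generator (m : ℕ) {ζ₀ : MuCarrier K (p ^ m)} (hgen : ∀ ζ : MuCarrier K (p ^ m), ∃ k : ℤ, ζ = k • ζ₀) (w : OMuCarrier K S (p ^ m)) :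
    ∃ b : padicCoeffIntegers S, w = OMuCarrier.tmul b ζ₀ := by
  induction w using OMuCarrier.induction_on with
  | zero => exact ⟨0, (zero_tmul_eq K S ζ₀).symm⟩
  | tmul a v =>
    obtain ⟨k, rfl⟩ := hgen v
    exact ⟨k • a, tmul_zsmul_eq K S a k ζ₀⟩
  | add y z hy hz =>
    obtain ⟨b, rfl⟩ := hy
    obtain ⟨c, rfl⟩ := hz
    exact ⟨b + c, (OMuCarrier.add_tmul S b c ζ₀).symm⟩

end Mu

/-! ## §3. The value of the level pairing and its perfectness -/

section Perf

variable {K : Type} [Field K] [NumberField K] {p : ℕ} [Fact p.Prime] (S : Set (PadicAlgCl p)) (lam : padicCoeffIntegers S →+ ℤ_[p])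
  (hlam : ∀ (c : ℤ_[p]) (y : padicCoeffIntegers S), lam (padicIntToCoeffIntegers S c * y) = c * lam y)
  (θ' : absoluteGaloisGroup K →ₜ* (padicCoeffIntegers S)ˣ) (P : Set (HeightOneSpectrum (𝓞 K))) (θ : FramedGaloisRep K (padicCoeffIntegers S) 1)
  (hstabK : ∀ m : Cofree θ (padicCoeffField S), IsOpen (MulAction.stabilizer (absoluteGaloisGroup K) m : Set (absoluteGaloisGroup K)))
  (hθ : ∀ σ : absoluteGaloisGroup K,
    ((θ' σ : (padicCoeffIntegers S)ˣ) : padicCoeffIntegers S) * ((θ σ : GL (Fin 1) (padicCoeffIntegers S)) : Matrix (Fin 1) (Fin 1) (padicCoeffIntegers S)) 0 0 = 1)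

include hlam in
/-- **The value of the level pairing**: `⟪x, t/p^m⟫ = (λ(b·t₀) mod p^m)·ζ` for `x ∈ X_m` with underlying tensor `b ⊗ ζ`. [cite: Rubin2000, §4.2] [cite: NeukirchSchmidtWingberg2008, (7.2.6)] -/
theorem cofreeLamCoeffPairingK_toLin_tmul_divPowTors (m : ℕ)
    (x : ↥(Representation.invariants ((muTwistO S θ' m).toRepresentation.comp (ramificationSubgroup K P).subtype)))
    {b : padicCoeffIntegers S} {ζ : MuCarrier K (p ^ m)} (hx : (x : OMuCarrier K S (p ^ m)) = OMuCarrier.tmul b ζ)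
    (t : Fin 1 → padicCoeffIntegers S) :
    (cofreeLamCoeffPairingK S lam hlam θ' P θ hstabK hθ m).toLin x (divPowTors S K θ m t) =
      (haveI : NeZero (p ^ m) := ⟨pow_ne_zero _ (Fact.out : p.Prime).ne_zero⟩; zmodSMulMu K (p ^ m) ζ (lamZMod S lam m (b * t 0))) := by
  rw [cofreeLamCoeffPairingK_toLin, hx, cofreeLamPairing_divPowTors, lamPairing_tmul]

include hlam in
/-- ★★★ **`hperf` AT LEVEL `m` FROM (i) + (ii).** If (i) `N_P` acts trivially on `𝒪 ⊗ μ_{p^m} ⊗ θ′` (`θ′|_{N_P} = 1`, `N_P` fixes `μ_{p^m}`) and (ii) `λ mod p^m` is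
PERFECT — non-degenerate (`hlamInj`: `λ(b t) ≡ 0 ∀ b ⇒ t ∈ p^m𝒪`) and onto (`hlamSurj`: every additive `g : 𝒪 → ℤ/p^m` is `b ↦ λ(b t)`) — then
`a ↦ ⟪·, a⟫ : M[p^m] → Hom_ℤ(X_m, μ_{p^m})` is BIJECTIVE for the global `λ`-pairing `cofreeLamCoeffPairingK` (the hypothesis `hperf m` of `exists_junction_exact_cofree_lam_free`).
Injectivity: test against `b ⊗ ζ₀`; surjectivity: `f ↦ g(b) := e(f(b ⊗ ζ₀))`, `t` from `hlamSurj`, and `𝒪 ⊗ μ_{p^m} = {b ⊗ ζ₀}`. [cite: Rubin2000, §4.2]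
[cite: NeukirchSchmidtWingberg2008, (7.2.6), I §5 Prop. 1.5.3] [cite: Kato2004Asterisque, §13.8, §17.13] -/
theorem bijective_flip_cofreeLamCoeffPairingK (m : ℕ) (hθN : ∀ g ∈ ramificationSubgroup K P, θ' g = 1)
    (hμN : ∀ g ∈ ramificationSubgroup K P, ∀ ζ : MuCarrier K (p ^ m), mu K (p ^ m) g ζ = ζ)
    (hlamInj : ∀ t : padicCoeffIntegers S, (∀ b : padicCoeffIntegers S, lamZMod S lam m (b * t) = 0) →
      t ∈ Ideal.span {((p : ℕ) : padicCoeffIntegers S) ^ m})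
    (hlamSurj : ∀ g : padicCoeffIntegers S →+ ZMod (p ^ m), ∃ t : padicCoeffIntegers S, ∀ b : padicCoeffIntegers S, g b = lamZMod S lam m (b * t)) :
    Bijective fun a : ↥(torsionPow (Cofree θ (padicCoeffField S)) p m) ↦ (cofreeLamCoeffPairingK S lam hlam θ' P θ hstabK hθ m).toLin.flip a := by
  haveI : NeZero (p ^ m) := ⟨pow_ne_zero _ (Fact.out : p.Prime).ne_zero⟩
  obtain ⟨e, ζ₀, he1, hgen, hord⟩ := exists_generator_muCarrier K (p := p) m
  -- the invariant pure tensors `b ⊗ ζ₀`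
  let xb : padicCoeffIntegers S → ↥(Representation.invariants ((muTwistO S θ' m).toRepresentation.comp (ramificationSubgroup K P).subtype)) :=
    fun b ↦ ⟨OMuCarrier.tmul b ζ₀, mem_invariants_muTwistO_of_forall S θ' P m hθN hμN _⟩
  have hxb : ∀ b, ((xb b : ↥(Representation.invariants ((muTwistO S θ' m).toRepresentation.comp (ramificationSubgroup K P).subtype))) :
      OMuCarrier K S (p ^ m)) = OMuCarrier.tmul b ζ₀ := fun _ ↦ rfl
  -- `zmodSMulMu ζ₀ ∘ e = id` and `zmodSMulMu ζ₀ r = 0 ↔ r = 0`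
  have hsm : ∀ y : MuCarrier K (p ^ m), zmodSMulMu K (p ^ m) ζ₀ (e y) = y := by
    intro y
    conv_rhs => rw [hgen y]
    rw [← zmodSMulMu_intCast K (p ^ m) ζ₀ ((e y).val : ℤ), Int.cast_natCast, ZMod.natCast_zmod_val]
  have hsm0 : ∀ r : ZMod (p ^ m), zmodSMulMu K (p ^ m) ζ₀ r = 0 → r = 0 := by
    intro r hr
    obtain ⟨w, rfl⟩ := ZMod.intCast_surjective r
    rw [zmodSMulMu_intCast] at hr
    exact (ZMod.intCast_zmod_eq_zero_iff_dvd w (p ^ m)).mpr ((hord w).mp hr)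
  constructor
  · -- ### injectivity: test against `b ⊗ ζ₀`
    rw [show (fun a : ↥(torsionPow (Cofree θ (padicCoeffField S)) p m) ↦ (cofreeLamCoeffPairingK S lam hlam θ' P θ hstabK hθ m).toLin.flip a) =
        ⇑(cofreeLamCoeffPairingK S lam hlam θ' P θ hstabK hθ m).toLin.flip from rfl, injective_iff_map_eq_zero]
    intro a ha
    obtain ⟨t, rfl⟩ := exists_divPowTors_eq S K θ m a
    have hval : ∀ b : padicCoeffIntegers S, lamZMod S lam m (b * t 0) = 0 := by
      intro b
      have h1 := LinearMap.congr_fun ha (xb b)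
      rw [LinearMap.flip_apply, LinearMap.zero_apply, cofreeLamCoeffPairingK_toLin_tmul_divPowTors S lam hlam θ' P θ hstabK hθ m (xb b) (hxb b) t] at h1
      exact hsm0 _ h1
    apply Subtype.ext
    rw [coe_divPowTors_apply, ZeroMemClass.coe_zero, divPowCofreeMk_eq_zero_iff]
    intro i
    rw [Subsingleton.elim i 0]
    exact hlamInj (t 0) hval
  · -- ### surjectivity: read `f` on `b ⊗ ζ₀` through `e`, solve with `hlamSurj`
    intro f
    let g : padicCoeffIntegers S →+ ZMod (p ^ m) :=
      { toFun := fun b ↦ e (f (xb b))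
        map_zero' := by
          have h0 : xb 0 = 0 := Subtype.ext (by rw [hxb, zero_tmul_eq]; rfl)
          rw [h0, map_zero, map_zero]
        map_add' := fun b c ↦ by
          have hadd : xb (b + c) = xb b + xb c := Subtype.ext (by rw [hxb]; exact OMuCarrier.add_tmul S b c ζ₀)
          rw [hadd, map_add, map_add] }
    obtain ⟨t, ht⟩ := hlamSurj g
    refine ⟨divPowTors S K θ m (fun _ ↦ t), LinearMap.ext fun x ↦ ?_⟩
    obtain ⟨b, hb⟩ := exists_eq_tmul_of_generator K S m (fun ζ ↦ ⟨_, hgen ζ⟩) (x : OMuCarrier K S (p ^ m))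
    have hxx : x = xb b := Subtype.ext hb
    rw [LinearMap.flip_apply, cofreeLamCoeffPairingK_toLin_tmul_divPowTors S lam hlam θ' P θ hstabK hθ m x hb, ← ht b, hxx]
    exact hsm _

end Perf

end Summit.BirchSwinnertonDyer.BirchSwinnertonDyer.Theorems.SmallImageRttD2Seq

end
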